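import Literature.Analysis.FluidPDE.GalerkinFlow
import Summits.AnomalousDissipation.AnomalousDissipation.Theses.WazewskiBlock
import HarnessLib

/-!
# Sketch — crux-ideate stmt-AnomalousDissipation-10352 (UniformGalerkinTrap), ideator 2, round 1

First lemmas of two crux idea cards — ALL PROVED (`lean check` rc 0, 0 sorries, axioms propext /
Classical.choice / Quot.sound):

* `finiteHorizonTrap` (card `rybakowski-ladder`): at the Galerkin level the pointwise-forever block
  condition is equivalent to finite-horizon trapping for every horizon `T` (compactness of the block in
  the finite-dimensional Galerkin phase space + joint continuity of `Torus.galerkinFlow`); this is the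
  first brick of any persistence / continuation argument (PDE invariant set ⟶ Galerkin orbits).
* `work_hasDerivWithinAt` (card `quadric-exit-homology`): along any trajectory satisfying the crux's
  own tested Galerkin clause with the test field `a := f`, the work `W(t) = ∫⟪f, U t⟫` is differentiable
  with derivative `Q_f(U t) + ν ∫⟪U t, Δf⟫ + ‖f‖²`, where `Q_f(U) = ∫⟪U, (U·∇)f⟫` is the instantaneous
  stress form; hence the work-face exit condition of the block is the QUADRATIC inequality
  `Q_f(U) + ν∫⟪U,Δf⟫ + ‖f‖² < 0` on `{W = ε₀}`.
-/

namespace Summit.AnomalousDissipation.AnomalousDissipation.Cruxes.UniformGalerkinTrap.Sketch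

open scoped InnerProductSpace ENNReal NNReal
open MeasureTheory Set Filter Topology
open Literature.Analysis.FunctionSpaces Literature.Analysis.FunctionSpaces.Torus
open Literature.Analysis.FluidPDE

local notation "𝕋³" => UnitAddTorus (Fin 3)
local notation "E³" => EuclideanSpace ℝ (Fin 3)

/-- The loud bounded block of the crux at Galerkin order `N`: Galerkin modes of order `N` with
energy cap `E`, work floor `ε₀` and (spectral) enstrophy cap `G`. -/
def block (N : ℕ) (f : 𝕋³ → E³) (E ε₀ : ℝ) (G : ℝ≥0) : Set (𝕋³ → E³) :=
  {a | IsGalerkinMode N a ∧ kineticEnergy a ≤ E ∧ ε₀ ≤ ∫ x, ⟪f x, a x⟫_ℝ ∧ eGradNormSq a ≤ (G : ℝ≥0∞)}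

/-- The instantaneous stress form `Q_f(U) = ∫⟪U, (U·∇)f⟫ = b(U, f, U)` (Reynolds stress of `U` against
the strain of the force profile). -/
noncomputable def stressForm (f U : 𝕋³ → E³) : ℝ :=
  ∫ x, ⟪U x, convect U f x⟫_ℝ

/-- **First lemma of card `rybakowski-ladder` (finite-horizon reduction, Galerkin level).**
For `ν ≥ 0`, `f ∈ L²`, and the block `B` of order `N`: if for every horizon `T ≥ 0` some point of `B`
has its Galerkin orbit in `B` on `[0, T]`, then some point of `B` has its whole forward orbit in `B`.
PROVED: transport to coefficient space (`fourierRestrict` / `realTrigPoly ∘ coeffExt`), where the block is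
closed (continuous face functionals `kineticEnergy_realTrigPoly_coeffExt`, `integral_inner_realTrigPoly_right`,
`eGradNormSq_realTrigPoly`; closed phase space) and bounded (energy cap), hence compact; the sets
`K_n = {c ∈ B | orbit ⊂ B on [0,n]}` are closed (`continuousOn_galerkinCoeffFlow`), nested and non-empty;
Cantor's intersection theorem. -/
theorem finiteHorizonTrap {ν : ℝ} (hν : 0 ≤ ν) {f : 𝕋³ → E³} (hf : MemLp f 2 volume)
    (N : ℕ) (E ε₀ : ℝ) (G : ℝ≥0)
    (h : ∀ T : ℝ, 0 ≤ T → ∃ a ∈ block N f E ε₀ G,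
      ∀ t ∈ Icc (0 : ℝ) T, Torus.galerkinFlow ν f N t a ∈ block N f E ε₀ G) :
    ∃ a ∈ block N f E ε₀ G, ∀ t : ℝ, 0 ≤ t → Torus.galerkinFlow ν f N t a ∈ block N f E ε₀ G := by
  classical
  -- coefficient set-up
  set S : Finset (Fin 3 → ℤ) := freqBall N with hSdef
  have hS : ∀ k ∈ S, -k ∈ S := neg_mem_freqBall_of_mem
  have hfi : Integrable f volume := hf.integrable one_le_two
  set g : ↥S → EuclideanSpace ℂ (Fin 3) := fourierRestrict S f with hgdef
  have hg : IsRealCoeff g := isRealCoeff_mFourierCoeff hfi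
  set P : Set (↥S → EuclideanSpace ℂ (Fin 3)) :=
    (galerkinSubspace S : Set (↥S → EuclideanSpace ℂ (Fin 3))) with hPdef
  set fhat : (Fin 3 → ℤ) → EuclideanSpace ℂ (Fin 3) :=
    fun k => UnitAddTorus.mFourierCoeff (EuclideanSpace.complexify ∘ f) k with hfhat
  -- the three face functionals in coefficients
  set KEc : (↥S → EuclideanSpace ℂ (Fin 3)) → ℝ := fun c => 2⁻¹ * ∑ k, ‖c k‖ ^ 2 with hKEc
  set Wc : (↥S → EuclideanSpace ℂ (Fin 3)) → ℝ :=
    fun c => ∑ k ∈ S, (inner ℂ (fhat k) (coeffExt S c k)).re with hWc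
  set Zc : (↥S → EuclideanSpace ℂ (Fin 3)) → ℝ :=
    fun c => 4 * Real.pi ^ 2 * ∑ k ∈ S, freqNormSq k * ‖coeffExt S c k‖ ^ 2 with hZc
  set rtp : (↥S → EuclideanSpace ℂ (Fin 3)) → (𝕋³ → E³) :=
    fun c => realTrigPoly S (coeffExt S c) with hrtp
  -- continuity of the coefficient functionals
  have hcoeff : ∀ k, Continuous fun c : ↥S → EuclideanSpace ℂ (Fin 3) => coeffExt S c k := by
    intro k
    unfold coeffExt
    split_ifs with hk
    · exact continuous_apply _
    · exact continuous_const
  have hKEcont : Continuous KEc :=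
    continuous_const.mul (continuous_finsetSum _ fun k _ => ((continuous_apply k).norm).pow 2)
  have hWcont : Continuous Wc := by
    refine continuous_finsetSum _ fun k _ => ?_
    exact Complex.continuous_re.comp (continuous_const.inner (hcoeff k))
  have hZcont : Continuous Zc :=
    continuous_const.mul (continuous_finsetSum _ fun k _ =>
      continuous_const.mul (((hcoeff k).norm).pow 2))
  -- dictionary: for `c ∈ P`, the three functionals of `rtp c`
  have hdict : ∀ c ∈ P, kineticEnergy (rtp c) = KEc c ∧ (∫ x, ⟪f x, rtp c x⟫_ℝ) = Wc c ∧
      eGradNormSq (rtp c) = ENNReal.ofReal (Zc c) := by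
    intro c hc
    have hcs : IsConjSymm (coeffExt S c) := hc.1.isConjSymm_coeffExt hS
    exact ⟨kineticEnergy_realTrigPoly_coeffExt hS hc.1,
      integral_inner_realTrigPoly_right hS hcs hf, eGradNormSq_realTrigPoly hS hcs⟩
  -- the coefficient block
  set Bc : Set (↥S → EuclideanSpace ℂ (Fin 3)) :=
    {c | c ∈ P ∧ KEc c ≤ E ∧ ε₀ ≤ Wc c ∧ Zc c ≤ (G : ℝ)} with hBc
  have hmem : ∀ c ∈ P, (c ∈ Bc ↔ rtp c ∈ block N f E ε₀ G) := by
    intro c hc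
    obtain ⟨h1, h2, h3⟩ := hdict c hc
    have hmode : IsGalerkinMode N (rtp c) := isGalerkinMode_realTrigPoly_coeffExt hc
    simp only [hBc, block, Set.mem_setOf_eq, h1, h2, h3]
    rw [show ((G : ℝ≥0∞)) = ENNReal.ofReal (G : ℝ) from (ENNReal.ofReal_coe_nnreal).symm,
      ENNReal.ofReal_le_ofReal_iff G.coe_nonneg]
    tauto
  -- `Bc` is compact
  have hPclosed : IsClosed P := (galerkinSubspace S).closed_of_finiteDimensional
  have hBcclosed : IsClosed Bc := by
    have : Bc = P ∩ (KEc ⁻¹' Iic E ∩ (Wc ⁻¹' Ici ε₀ ∩ Zc ⁻¹' Iic (G : ℝ))) := by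
      ext c; simp only [hBc, Set.mem_setOf_eq, Set.mem_inter_iff, Set.mem_preimage, Set.mem_Iic, Set.mem_Ici]
    rw [this]
    exact hPclosed.inter ((isClosed_Iic.preimage hKEcont).inter
      ((isClosed_Ici.preimage hWcont).inter (isClosed_Iic.preimage hZcont)))
  have hBcbdd : Bornology.IsBounded Bc := by
    refine (Metric.isBounded_closedBall (x := (0 : ↥S → EuclideanSpace ℂ (Fin 3)))
      (r := Real.sqrt (2 * E))).subset fun c hc => ?_
    rw [Metric.mem_closedBall, dist_zero_right, pi_norm_le_iff_of_nonneg (Real.sqrt_nonneg _)]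
    intro k
    have hk : ‖c k‖ ^ 2 ≤ 2 * E := by
      have hsum : ‖c k‖ ^ 2 ≤ ∑ j, ‖c j‖ ^ 2 :=
        Finset.single_le_sum (f := fun j => ‖c j‖ ^ 2) (fun j _ => sq_nonneg _) (Finset.mem_univ k)
      have := hc.2.1
      simp only [hKEc] at this
      linarith
    calc ‖c k‖ = Real.sqrt (‖c k‖ ^ 2) := (Real.sqrt_sq (norm_nonneg _)).symm
      _ ≤ Real.sqrt (2 * E) := Real.sqrt_le_sqrt hk
  have hBccpt : IsCompact Bc := Metric.isCompact_of_isClosed_isBounded hBcclosed hBcbdd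
  -- the coefficient flow and its continuity at fixed times
  set Φ : ℝ → (↥S → EuclideanSpace ℂ (Fin 3)) → (↥S → EuclideanSpace ℂ (Fin 3)) :=
    galerkinCoeffFlow ν g with hΦ
  have hΦcont : ∀ t : ℝ, 0 ≤ t → ContinuousOn (Φ t) P := by
    intro t ht
    have hj := continuousOn_galerkinCoeffFlow hν hS hg (ν := ν)
    exact hj.comp (continuousOn_const.prodMk continuousOn_id) fun c hc => ⟨ht, hc⟩
  -- nested closed sets K n
  set K : ℕ → Set (↥S → EuclideanSpace ℂ (Fin 3)) :=
    fun n => Bc ∩ ⋂ t ∈ Icc (0 : ℝ) n, {c | c ∈ P ∧ Φ t c ∈ Bc} with hK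
  have hKclosed : ∀ n, IsClosed (K n) := by
    intro n
    refine hBcclosed.inter (isClosed_biInter fun t ht => ?_)
    exact (hΦcont t ht.1).preimage_isClosed_of_isClosed hPclosed hBcclosed
  have hKanti : ∀ n, K (n + 1) ⊆ K n := by
    intro n c hc
    refine ⟨hc.1, Set.mem_iInter₂.2 fun t ht => ?_⟩
    have ht' : t ∈ Icc (0 : ℝ) (n + 1 : ℕ) := ⟨ht.1, ht.2.trans (by push_cast; linarith)⟩
    exact Set.mem_iInter₂.1 hc.2 t ht'
  have hKne : ∀ n, (K n).Nonempty := by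
    intro n
    obtain ⟨a, ha, htraj⟩ := h n (Nat.cast_nonneg n)
    have hmode : IsGalerkinMode N a := ha.1
    set c := fourierRestrict S a with hcdef
    have hcP : c ∈ P := hmode.fourierRestrict_mem
    have hca : rtp c = a := hmode.realTrigPoly_fourierRestrict
    refine ⟨c, (hmem c hcP).2 (hca ▸ ha), Set.mem_iInter₂.2 fun t ht => ⟨hcP, ?_⟩⟩
    have hmode_t : IsGalerkinMode N (Torus.galerkinFlow ν f N t a) := hmode.isGalerkinMode_galerkinFlow t
    have hΦt : Φ t c = fourierRestrict S (Torus.galerkinFlow ν f N t a) :=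
      (hmode.fourierRestrict_galerkinFlow t).symm
    have hΦP : Φ t c ∈ P := by rw [hΦt]; exact hmode_t.fourierRestrict_mem
    refine (hmem _ hΦP).2 ?_
    rw [show rtp (Φ t c) = Torus.galerkinFlow ν f N t a by
      rw [hΦt]; exact hmode_t.realTrigPoly_fourierRestrict]
    exact htraj t ht
  have hK0 : IsCompact (K 0) := hBccpt.of_isClosed_subset (hKclosed 0) Set.inter_subset_left
  obtain ⟨c, hc⟩ := IsCompact.nonempty_iInter_of_sequence_nonempty_isCompact_isClosed K hKanti hKne hK0 hKclosed
  have hcK : ∀ n, c ∈ K n := fun n => Set.mem_iInter.1 hc n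
  have hcBc : c ∈ Bc := (hcK 0).1
  have hcP : c ∈ P := hcBc.1
  refine ⟨rtp c, (hmem c hcP).1 hcBc, fun t ht => ?_⟩
  -- pick an integer horizon beyond `t`
  obtain ⟨n, hn⟩ := exists_nat_ge t
  have hΦBc : Φ t c ∈ Bc := (Set.mem_iInter₂.1 (hcK n).2 t ⟨ht, hn⟩).2
  have hΦP : Φ t c ∈ P := hΦBc.1
  have hflow : Torus.galerkinFlow ν f N t (rtp c) = rtp (Φ t c) := Torus.galerkinFlow_realTrigPoly hcP t
  rw [hflow]
  exact (hmem _ hΦP).1 hΦBc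

/-- **Consequence used by the card**: a trapped forward orbit of the Galerkin semiflow IS a witness of
the crux's inner existential at `(ν, N)` (the four clauses are `IsGalerkinMode.galerkinFlow_clauses`,
in tree), so `UniformGalerkinTrap` at order `N` follows from finite-horizon trapping for all `T`. -/
theorem trap_of_finiteHorizon {ν : ℝ} (hν : 0 ≤ ν) {f : 𝕋³ → E³} (hf : MemLp f 2 volume)
    (N : ℕ) (E ε₀ : ℝ) (G : ℝ≥0)
    (h : ∀ T : ℝ, 0 ≤ T → ∃ a ∈ block N f E ε₀ G,
      ∀ t ∈ Icc (0 : ℝ) T, Torus.galerkinFlow ν f N t a ∈ block N f E ε₀ G) :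
    ∃ U : ℝ → 𝕋³ → E³,
      (ContinuousOn (stLift U) (Ici 0 ×ˢ univ) ∧
      (∀ t : ℝ, 0 ≤ t → IsGalerkinMode N (U t) ∧ IsWeaklyDivFree (U t)) ∧
      (∀ b : 𝕋³ → E³, IsGalerkinMode N b → ∀ s t : ℝ, 0 ≤ s → s ≤ t →
        (∫ x, ⟪U t x, b x⟫_ℝ) - ∫ x, ⟪U s x, b x⟫_ℝ =
          ∫ τ in s..t, ∫ x, (⟪U τ x, convect (U τ) b x⟫_ℝ + ν * ⟪U τ x, laplacian b x⟫_ℝ + ⟪f x, b x⟫_ℝ)) ∧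
      (∀ s t : ℝ, 0 ≤ s → s ≤ t →
        kineticEnergy (U t) + ν * (∫⁻ τ in Ioo s t, eGradNormSq (U τ)).toReal =
          kineticEnergy (U s) + ∫ τ in s..t, ∫ x, ⟪f x, U τ x⟫_ℝ)) ∧
      ∀ t : ℝ, 0 ≤ t → kineticEnergy (U t) ≤ E ∧ ε₀ ≤ (∫ x, ⟪f x, U t x⟫_ℝ) ∧
        eGradNormSq (U t) ≤ (G : ℝ≥0∞) := by
  obtain ⟨a, ha, htrap⟩ := finiteHorizonTrap hν hf N E ε₀ G h
  refine ⟨fun t => Torus.galerkinFlow ν f N t a, ?_⟩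
  obtain ⟨-, hcont, hslice, hgal, hen⟩ := ha.1.galerkinFlow_clauses hν hf (ν := ν)
  refine ⟨⟨hcont, hslice, hgal, hen⟩, fun t ht => ?_⟩
  exact ⟨(htrap t ht).2.1, (htrap t ht).2.2.1, (htrap t ht).2.2.2⟩

/-- **First lemma of card `quadric-exit-homology` (the work face is a quadric).** Along a trajectory
`U` on `[0, ∞)` which satisfies the tested Galerkin identity of the crux against the force itself (`f` is
a Galerkin mode of order `m ≤ N`, so clause (c) of the crux applies with `a := f`), if the tested
integrand `g τ = ∫ (⟪U τ, (U τ·∇)f⟫ + ν⟪U τ, Δf⟫ + ⟪f,f⟫)` is continuous on `[0,∞)` then the work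
`W τ = ∫⟪f, U τ⟫` is differentiable from the right at every `t ≥ 0` with derivative `g t`. For smooth
slices the three summands are integrable and `g t = stressForm f (U t) + ν∫⟪U t, Δf⟫ + ‖f‖₂²`, so on the
face `{W = ε₀}` the exit condition `Ẇ < 0` is the QUADRATIC inequality
`stressForm f (U t) + ν ∫⟪U t, Δ f⟫ + ∫‖f‖² < 0` in `U t`. PROVED (FTC). -/
theorem work_hasDerivWithinAt {ν : ℝ} {f : 𝕋³ → E³} (U : ℝ → 𝕋³ → E³)
    (hgal : ∀ s t : ℝ, 0 ≤ s → s ≤ t →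
      (∫ x, ⟪U t x, f x⟫_ℝ) - ∫ x, ⟪U s x, f x⟫_ℝ =
        ∫ τ in s..t, ∫ x, (⟪U τ x, convect (U τ) f x⟫_ℝ + ν * ⟪U τ x, laplacian f x⟫_ℝ + ⟪f x, f x⟫_ℝ))
    (hcont : ContinuousOn
      (fun τ => ∫ x, (⟪U τ x, convect (U τ) f x⟫_ℝ + ν * ⟪U τ x, laplacian f x⟫_ℝ + ⟪f x, f x⟫_ℝ)) (Ici 0))
    {t : ℝ} (ht : 0 ≤ t) :
    HasDerivWithinAt (fun τ => ∫ x, ⟪f x, U τ x⟫_ℝ)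
      (∫ x, (⟪U t x, convect (U t) f x⟫_ℝ + ν * ⟪U t x, laplacian f x⟫_ℝ + ⟪f x, f x⟫_ℝ)) (Ici t) t := by
  set g : ℝ → ℝ := fun τ =>
    ∫ x, (⟪U τ x, convect (U τ) f x⟫_ℝ + ν * ⟪U τ x, laplacian f x⟫_ℝ + ⟪f x, f x⟫_ℝ) with hg
  -- the work written with the arguments of the inner product swapped
  have hW : (fun τ => ∫ x, ⟪f x, U τ x⟫_ℝ) = fun τ => ∫ x, ⟪U τ x, f x⟫_ℝ := by
    funext τ
    exact integral_congr_ae (Filter.Eventually.of_forall fun x => real_inner_comm _ _)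
  rw [hW]
  -- `g` is continuous on a neighbourhood of `t` within `[t, ∞)`, hence interval integrable near `t`
  have hcont_t : ContinuousWithinAt g (Ioi t) t :=
    (hcont.continuousWithinAt (self_mem_Ici (a := 0) |> fun _ => ht)).mono fun τ hτ => le_trans ht (le_of_lt hτ)
  have hmeas : StronglyMeasurableAtFilter g (𝓝[>] t) volume := by
    have h1 : ContinuousOn g (Ioi t) := hcont.mono fun τ hτ => le_trans ht (le_of_lt hτ)
    exact h1.stronglyMeasurableAtFilter_nhdsWithin measurableSet_Ioi t
  have hint : IntervalIntegrable g volume t t := IntervalIntegrable.refl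
  -- FTC at the right endpoint, within `Ici t`
  have hF : HasDerivWithinAt (fun u => ∫ τ in t..u, g τ) (g t) (Ici t) t :=
    intervalIntegral.integral_hasDerivWithinAt_right hint hmeas hcont_t
  have hF' : HasDerivWithinAt (fun u => (∫ x, ⟪U t x, f x⟫_ℝ) + ∫ τ in t..u, g τ) (g t) (Ici t) t := by
    simpa using hF.const_add (∫ x, ⟪U t x, f x⟫_ℝ)
  -- the two functions agree on `Ici t` by the tested Galerkin identity
  refine hF'.congr_of_eventuallyEq ?_ ?_
  · filter_upwards [self_mem_nhdsWithin] with u hu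
    have := hgal t u ht hu
    simp only [hg] at this ⊢
    linarith
  · simp

/-- **Exit-set formula for the two quadratic faces (statement).** With face functions
`h₁ = E − KE`, `h₂ = W − ε₀` along the Galerkin flow, the flow derivatives are `d₁ = νZ − W`
(energy identity, exact) and `d₂ = Q_f + ν(U,Δf) + ‖f‖²` (lemma above); by
`Literature.Dynamics.ConleyIndex.IsRegularPolyfacial.blockExitSet_eq` the exit set of the two-face block is
`{KE = E ∧ W − νZ > 0} ∪ {W = ε₀ ∧ Q_f(U) + ν(U,Δf) + ‖f‖² < 0}` — a union of two basic semialgebraic sets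
each cut out by ≤ 4 polynomials of degree ≤ 2 in the Galerkin coefficients. Recorded here as the Prop the
card computes the homology of. -/
def quadricExitSet (N : ℕ) (ν : ℝ) (f : 𝕋³ → E³) (E ε₀ : ℝ) : Set (𝕋³ → E³) :=
  {a | IsGalerkinMode N a ∧ kineticEnergy a ≤ E ∧ ε₀ ≤ ∫ x, ⟪f x, a x⟫_ℝ ∧
    ((kineticEnergy a = E ∧ ν * (eGradNormSq a).toReal < ∫ x, ⟪f x, a x⟫_ℝ) ∨
     ((∫ x, ⟪f x, a x⟫_ℝ) = ε₀ ∧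
       stressForm f a + ν * (∫ x, ⟪a x, laplacian f x⟫_ℝ) + ∫ x, ‖f x‖ ^ 2 < 0))}

end Summit.AnomalousDissipation.AnomalousDissipation.Cruxes.UniformGalerkinTrap.Sketch
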